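import Summits.QuantumFields.BalabanUV.Beta.GAN24.T2DevConservationDefectRows
import Summits.QuantumFields.BalabanUV.Beta.GAN24.KSlotAssembly
import Summits.QuantumFields.BalabanUV.Beta.GAN24.T2RecSourceRows
import Summits.QuantumFields.BalabanUV.Beta.GAN24.T2UndressedCombShapeEnd

/-!
# `BalabanUV.Beta.GAN24.T2DevConservationDefectThree` — binder row G-an2-4 / (CONV-C), W-slot CT-W, route «WC-TL» (RULING R-gan24p1-g24-1 ∕ -2), A-0 in DEVIATION FORM:
# **THE A-0 ROWS (H) ∧ (H-rate) OF THE `d = 3` COMB TOWER FROM THE ORBIT's DRESSING-DEFECT ROWS ALONE, every source row and K row discharged by name** (companion of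
# `T2DevConservationDefectRows`, this lineage's INTENT I-leaf01-g63-3, journal l.39345).

NOT IN PRINT; OUR BOOKKEEPING ([folklore] composition BY NAME: `T2DevConservationDefectRows.exists_hH_of_defect_rows ∕ exists_hHr_of_defect_rows` ∘ road P1's
`KSlotAssembly.convCKWall_holds` (K-slot `Decays` + Cauchy rows) ∘ p2's F4 `T2RecSourceRows.source_rows_three_of_srecAt_rows` over the OWNER's
`SrecAtSlotRowsFinal.exists_hS_hSall_SrecAt_three` (dressed source shape + Cauchy rows, hypothesis-free at `cE = Lc⁴`) ∘ leaf-04's (A)∕(B) `T2UndressedCombShapeEnd.source_rows_three_holds`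
(undressed twin); G-an2-4 formalisation swarm, leaf prover `b2b-balaban-gan24-formalise-leaf-01`, gen 63).  HONEST FRAMING (cell contract, verbatim): «discharging `BetaPertH` makes
Bałaban's UV stability UNCONDITIONAL — a real constructive-QFT result; it is NOT the continuum limit and NOT the Clay problem.»  HONEST DEPENDENCY (verbatim): «continuum YM on T⁴ ⇐
BetaPertH ∧ nine spine estimates (0/9 proved); BetaPertH ⇐ (D1) ∧ (D4) ∧ CAP+tail; G-an2-4 gates asym, D1 and NE2/3/4.»

* **`exists_hH_hHr_three_of_defect_rows`** (`2 ≤ Lc`, in-block root `r`, `cE = Lc⁴`, every `cVH cΛ cE₂ cB Tc`, any `LocStencil₂` border `vh₂S`): ROW (Q-D)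
  `∀ m, LocStencil₂ ((𝔇 − 1) T̃_m) CY δY` ∧ ROW (Q-D-rate) `∀ m, LocStencil₂ ((𝔇 − 1) T̃_{m+1} − (𝔇 − 1) T̃_m) (CY′·θY^m) δY′` ⟹ (H) ∧ (H-rate), the binders of
  `T2DevConservationDrift.t2Drift_T2RecAt_three_of_U_Ud_C_H_Hr` ∕ `T2DevConservationEnd.t2Shape_T2RecAt_three_of_U_C_H` token for token.
(Q-D) ∕ (Q-D-rate) are HYPOTHESES (T-DL ∕ SLAVE ∕ (Q-R) ∕ (Q-L) ∕ (Q-b), OPEN); asserts NO shape of Bałaban's tables; NOTHING of «T2Shape» ∕ «T2Drift» ∕ (hW, hWall) ∕ (C) discharged;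
NOT «W-slot closed»; NEVER «G-an2-4 closed» as (CONV-C); NOT D1, NOT `BetaPertH`, NOT continuum, NOT Clay.  0 cited facts, 0 `def`, 0 `def … : Prop`, 0 sorry.  2026-08-22.
-/

noncomputable section

open Finset
open scoped BigOperators
open Literature.MathematicalPhysics.QuantumFieldTheory
open Literature.MathematicalPhysics.QuantumFieldTheory.Balaban1983to89
open Literature.MathematicalPhysics.QuantumFieldTheory.Balaban1983to89.Beta
open ExpKernelCalculus (MKer Decays shiftK)
open OneStepResolventKernel (Fib LocStencil)
open OneStepKernelFamily (KInvStep)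
open AffineAveraging (box toSite)
open AveragingMixedJetTables (mixFFAt)
open SecondOrderResponse (W2SymOfK)
open BalabanCompositeJets (LocStencil₂)
open BalabanStepJetsSucc (mmRead)
open BalabanStepW2 (K3OfK M2Of)
open Summit.QuantumFields.BalabanUV.Beta.HessKerDressedUnits (unitK unitS)
open Summit.QuantumFields.BalabanUV.Beta.SecondOrderUnits (unitM unitS₂ unitM₂)
open Summit.QuantumFields.BalabanUV.Beta.AxialDressingRooted (coDressKBmAt dressKBmAt coProjBmAtK)
open Summit.QuantumFields.BalabanUV.Beta.SpineRooted (T2RecOf T2RecAt SpureRecAt M1At)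
open Summit.QuantumFields.BalabanUV.Beta.WardLocusRecursive (SrecAt)
open Summit.QuantumFields.BalabanUV.Beta.GAN24.CombesThomas (sfStep smStep)
open Summit.QuantumFields.BalabanUV.Beta.GAN24.T2RecursionAffine (lin4)
open Summit.QuantumFields.BalabanUV.Beta.GAN24.BiStencilZeroMode (Tab)
open Summit.QuantumFields.BalabanUV.Beta.GAN24.KSlotAssembly (convCKWall_holds)
open Summit.QuantumFields.BalabanUV.Beta.GAN24.SrecAtSlotRowsFinal (exists_hS_hSall_SrecAt_three)
open Summit.QuantumFields.BalabanUV.Beta.GAN24.T2UndressedCombShapeEnd (source_rows_three_holds)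
open Summit.QuantumFields.BalabanUV.Beta.GAN24.T2DevConservationDefectRows (exists_hH_of_defect_rows exists_hHr_of_defect_rows)

namespace Summit.QuantumFields.BalabanUV.Beta.GAN24.T2DevConservationDefectThree

/-! ## (H) ∧ (H-rate) at `d = 3` from the defect rows, every source row and K row discharged by name -/

section Three

variable {Lc : ℕ} [NeZero Lc] {r : Fin (3 + 1) → ℕ}

/-- NOT IN PRINT; OUR PROOF ATTEMPT ([folklore] §1 ∘ road P1's `KSlotAssembly.convCKWall_holds` (K-slot `Decays` + Cauchy rows) ∘ p2's F4
`T2RecSourceRows.source_rows_three_of_srecAt_rows` over the OWNER's `SrecAtSlotRowsFinal.exists_hS_hSall_SrecAt_three` (dressed source shape + Cauchy rows, hypothesis-free at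
`cE = Lc⁴`) ∘ leaf-04's (A)∕(B) `T2UndressedCombShapeEnd.source_rows_three_holds` (undressed twin)).  **THE A-0 ROWS (H) ∧ (H-rate) OF THE `d = 3` COMB TOWER FROM THE ORBIT's
DRESSING-DEFECT ROWS ALONE** (`2 ≤ Lc`, in-block root `r`, `cE = Lc⁴`, every `cVH cΛ cE₂ cB Tc`, any `LocStencil₂` border `vh₂S`): ROW (Q-D) `∀ m, LocStencil₂ ((𝔇 − 1) T̃_m) CY δY` and
ROW (Q-D-rate) `∀ m, LocStencil₂ ((𝔇 − 1) T̃_{m+1} − (𝔇 − 1) T̃_m) (CY′·θY^m) δY′` (`0 ≤ θY < 1`) ⟹ `∃ Ch δh Ch′ θh δh′, 0 < δh ∧ 0 ≤ θh ∧ θh < 1 ∧ 0 < δh′ ∧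
(∀ m, LocStencil₂ (h_m) Ch δh) ∧ (∀ m, LocStencil₂ (h_{m+1} − h_m) (Ch′·θh^m) δh′)` — the binders (H) `hH hδh` and (H-rate) `hHr hθh0 hθh1 hδh′` of
`T2DevConservationDrift.t2Drift_T2RecAt_three_of_U_Ud_C_H_Hr` token for token.  (Q-D) ∕ (Q-D-rate) are HYPOTHESES (T-DL ∕ SLAVE ∕ (Q-R) ∕ (Q-L) ∕ (Q-b), OPEN); NOT «W-slot
closed»; NEVER «G-an2-4 closed» as (CONV-C); NOT D1, NOT `BetaPertH`, NOT continuum, NOT Clay. -/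
theorem exists_hH_hHr_three_of_defect_rows (hLc : 2 ≤ Lc) (hr : r ∈ box (3 + 1) Lc) {cE : ℝ} (hcE : cE = (Lc : ℝ) ^ (3 + 1)) (cVH cΛ cE₂ cB : ℝ)
    (Tc : Fin 4 → Fin 4 → Fin 4 → Fin 4 → ℝ) {vh₂S : Tab 3} {CB δB : ℝ} (hB : LocStencil₂ vh₂S CB δB) (hδB : 0 < δB) {CY δY CY' θY δY' : ℝ}
    (hY : ∀ m : ℕ, LocStencil₂ ((fun κ u κ' u' => dressKBmAt (toSite r) Lc (coProjBmAtK (toSite r) Lc (fun κ₁ u₁ => coProjBmAtK (toSite r) Lc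
            ((unitS₂ (sfStep Lc m) (smStep 3 Lc m) (T2RecAt 3 Lc (toSite r) cE cVH cΛ cE₂ cB Tc vh₂S (mixFFAt (toSite r) Lc) m)) κ₁ u₁) κ' u') κ u)) -
          (unitS₂ (sfStep Lc m) (smStep 3 Lc m) (T2RecAt 3 Lc (toSite r) cE cVH cΛ cE₂ cB Tc vh₂S (mixFFAt (toSite r) Lc) m))) CY δY) (hδY : 0 < δY)
    (hYr : ∀ m : ℕ, LocStencil₂ (((fun κ u κ' u' => dressKBmAt (toSite r) Lc (coProjBmAtK (toSite r) Lc (fun κ₁ u₁ => coProjBmAtK (toSite r) Lc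
            ((unitS₂ (sfStep Lc (m + 1)) (smStep 3 Lc (m + 1)) (T2RecAt 3 Lc (toSite r) cE cVH cΛ cE₂ cB Tc vh₂S (mixFFAt (toSite r) Lc) (m + 1))) κ₁ u₁) κ' u') κ u)) -
          (unitS₂ (sfStep Lc (m + 1)) (smStep 3 Lc (m + 1)) (T2RecAt 3 Lc (toSite r) cE cVH cΛ cE₂ cB Tc vh₂S (mixFFAt (toSite r) Lc) (m + 1)))) -
      ((fun κ u κ' u' => dressKBmAt (toSite r) Lc (coProjBmAtK (toSite r) Lc (fun κ₁ u₁ => coProjBmAtK (toSite r) Lc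
            ((unitS₂ (sfStep Lc m) (smStep 3 Lc m) (T2RecAt 3 Lc (toSite r) cE cVH cΛ cE₂ cB Tc vh₂S (mixFFAt (toSite r) Lc) m)) κ₁ u₁) κ' u') κ u)) -
          (unitS₂ (sfStep Lc m) (smStep 3 Lc m) (T2RecAt 3 Lc (toSite r) cE cVH cΛ cE₂ cB Tc vh₂S (mixFFAt (toSite r) Lc) m)))) (CY' * θY ^ m) δY') (hθY0 : 0 ≤ θY) (hθY1 : θY < 1) (hδY' : 0 < δY') :
    ∃ Ch δh Ch' θh δh' : ℝ, 0 < δh ∧ 0 ≤ θh ∧ θh < 1 ∧ 0 < δh' ∧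
      (∀ m : ℕ, LocStencil₂ (((lin4 (cE₂ * (Lc : ℝ) ^ (2 * (3 + 1))) (unitK (sfStep Lc m) (smStep 3 Lc m) (coDressKBmAt (toSite r) Lc (KInvStep (d := 3) Lc m))) Lc
            (unitS₂ (sfStep Lc m) (smStep 3 Lc m) (T2RecAt 3 Lc (toSite r) cE cVH cΛ cE₂ cB Tc vh₂S (mixFFAt (toSite r) Lc) m)) -
          lin4 (cE₂ * (Lc : ℝ) ^ (2 * (3 + 1))) (unitK (sfStep Lc m) (smStep 3 Lc m) (KInvStep (d := 3) Lc m)) Lc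
            (unitS₂ (sfStep Lc m) (smStep 3 Lc m) (T2RecAt 3 Lc (toSite r) cE cVH cΛ cE₂ cB Tc vh₂S (mixFFAt (toSite r) Lc) m))) +
        ((fun κ u κ' u' => (cE₂ * (Lc : ℝ) ^ (2 * (3 + 1))) • mmRead Lc (K3OfK (unitK (sfStep Lc m) (smStep 3 Lc m) (coDressKBmAt (toSite r) Lc (KInvStep (d := 3) Lc m))) Lc
            (unitS (sfStep Lc m) (smStep 3 Lc m) (SpureRecAt 3 Lc (toSite r) cE cVH cΛ m)) (unitM (sfStep Lc m) (smStep 3 Lc m) (M1At 3 Lc (toSite r) cΛ m))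
            (W2SymOfK (unitK (sfStep Lc m) (smStep 3 Lc m) (coDressKBmAt (toSite r) Lc (KInvStep (d := 3) Lc m))) Lc (unitS (sfStep Lc m) (smStep 3 Lc m) (SpureRecAt 3 Lc (toSite r) cE cVH cΛ m))
              (unitM (sfStep Lc m) (smStep 3 Lc m) (M1At 3 Lc (toSite r) cΛ m)) 0 (unitM₂ (sfStep Lc m) (smStep 3 Lc m) (M2Of 3 Lc (mixFFAt (toSite r) Lc) m))) κ u κ' u')
          + cB • vh₂S κ u κ' u') -
         (fun κ u κ' u' => (cE₂ * (Lc : ℝ) ^ (2 * (3 + 1))) • mmRead Lc (K3OfK (unitK (sfStep Lc m) (smStep 3 Lc m) (KInvStep (d := 3) Lc m)) Lc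
            (unitS (sfStep Lc m) (smStep 3 Lc m) (SpureRecAt 3 Lc (toSite r) cE cVH cΛ m)) (unitM (sfStep Lc m) (smStep 3 Lc m) (M1At 3 Lc (toSite r) cΛ m))
            (W2SymOfK (unitK (sfStep Lc m) (smStep 3 Lc m) (KInvStep (d := 3) Lc m)) Lc (unitS (sfStep Lc m) (smStep 3 Lc m) (SpureRecAt 3 Lc (toSite r) cE cVH cΛ m))
              (unitM (sfStep Lc m) (smStep 3 Lc m) (M1At 3 Lc (toSite r) cΛ m)) 0 (unitM₂ (sfStep Lc m) (smStep 3 Lc m) (M2Of 3 Lc (mixFFAt (toSite r) Lc) m))) κ u κ' u')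
          + cB • vh₂S κ u κ' u')))) Ch δh) ∧
      (∀ m : ℕ, LocStencil₂ ((((lin4 (cE₂ * (Lc : ℝ) ^ (2 * (3 + 1))) (unitK (sfStep Lc (m + 1)) (smStep 3 Lc (m + 1)) (coDressKBmAt (toSite r) Lc (KInvStep (d := 3) Lc (m + 1)))) Lc
            (unitS₂ (sfStep Lc (m + 1)) (smStep 3 Lc (m + 1)) (T2RecAt 3 Lc (toSite r) cE cVH cΛ cE₂ cB Tc vh₂S (mixFFAt (toSite r) Lc) (m + 1))) -
          lin4 (cE₂ * (Lc : ℝ) ^ (2 * (3 + 1))) (unitK (sfStep Lc (m + 1)) (smStep 3 Lc (m + 1)) (KInvStep (d := 3) Lc (m + 1))) Lc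
            (unitS₂ (sfStep Lc (m + 1)) (smStep 3 Lc (m + 1)) (T2RecAt 3 Lc (toSite r) cE cVH cΛ cE₂ cB Tc vh₂S (mixFFAt (toSite r) Lc) (m + 1)))) +
        ((fun κ u κ' u' => (cE₂ * (Lc : ℝ) ^ (2 * (3 + 1))) • mmRead Lc (K3OfK (unitK (sfStep Lc (m + 1)) (smStep 3 Lc (m + 1)) (coDressKBmAt (toSite r) Lc (KInvStep (d := 3) Lc (m + 1)))) Lc
            (unitS (sfStep Lc (m + 1)) (smStep 3 Lc (m + 1)) (SpureRecAt 3 Lc (toSite r) cE cVH cΛ (m + 1))) (unitM (sfStep Lc (m + 1)) (smStep 3 Lc (m + 1)) (M1At 3 Lc (toSite r) cΛ (m + 1)))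
            (W2SymOfK (unitK (sfStep Lc (m + 1)) (smStep 3 Lc (m + 1)) (coDressKBmAt (toSite r) Lc (KInvStep (d := 3) Lc (m + 1)))) Lc (unitS (sfStep Lc (m + 1)) (smStep 3 Lc (m + 1)) (SpureRecAt 3 Lc (toSite r) cE cVH cΛ (m + 1)))
              (unitM (sfStep Lc (m + 1)) (smStep 3 Lc (m + 1)) (M1At 3 Lc (toSite r) cΛ (m + 1))) 0 (unitM₂ (sfStep Lc (m + 1)) (smStep 3 Lc (m + 1)) (M2Of 3 Lc (mixFFAt (toSite r) Lc) (m + 1)))) κ u κ' u')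
          + cB • vh₂S κ u κ' u') -
         (fun κ u κ' u' => (cE₂ * (Lc : ℝ) ^ (2 * (3 + 1))) • mmRead Lc (K3OfK (unitK (sfStep Lc (m + 1)) (smStep 3 Lc (m + 1)) (KInvStep (d := 3) Lc (m + 1))) Lc
            (unitS (sfStep Lc (m + 1)) (smStep 3 Lc (m + 1)) (SpureRecAt 3 Lc (toSite r) cE cVH cΛ (m + 1))) (unitM (sfStep Lc (m + 1)) (smStep 3 Lc (m + 1)) (M1At 3 Lc (toSite r) cΛ (m + 1)))
            (W2SymOfK (unitK (sfStep Lc (m + 1)) (smStep 3 Lc (m + 1)) (KInvStep (d := 3) Lc (m + 1))) Lc (unitS (sfStep Lc (m + 1)) (smStep 3 Lc (m + 1)) (SpureRecAt 3 Lc (toSite r) cE cVH cΛ (m + 1)))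
              (unitM (sfStep Lc (m + 1)) (smStep 3 Lc (m + 1)) (M1At 3 Lc (toSite r) cΛ (m + 1))) 0 (unitM₂ (sfStep Lc (m + 1)) (smStep 3 Lc (m + 1)) (M2Of 3 Lc (mixFFAt (toSite r) Lc) (m + 1)))) κ u κ' u')
          + cB • vh₂S κ u κ' u')))) -
        (((lin4 (cE₂ * (Lc : ℝ) ^ (2 * (3 + 1))) (unitK (sfStep Lc m) (smStep 3 Lc m) (coDressKBmAt (toSite r) Lc (KInvStep (d := 3) Lc m))) Lc
            (unitS₂ (sfStep Lc m) (smStep 3 Lc m) (T2RecAt 3 Lc (toSite r) cE cVH cΛ cE₂ cB Tc vh₂S (mixFFAt (toSite r) Lc) m)) -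
          lin4 (cE₂ * (Lc : ℝ) ^ (2 * (3 + 1))) (unitK (sfStep Lc m) (smStep 3 Lc m) (KInvStep (d := 3) Lc m)) Lc
            (unitS₂ (sfStep Lc m) (smStep 3 Lc m) (T2RecAt 3 Lc (toSite r) cE cVH cΛ cE₂ cB Tc vh₂S (mixFFAt (toSite r) Lc) m))) +
        ((fun κ u κ' u' => (cE₂ * (Lc : ℝ) ^ (2 * (3 + 1))) • mmRead Lc (K3OfK (unitK (sfStep Lc m) (smStep 3 Lc m) (coDressKBmAt (toSite r) Lc (KInvStep (d := 3) Lc m))) Lc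
            (unitS (sfStep Lc m) (smStep 3 Lc m) (SpureRecAt 3 Lc (toSite r) cE cVH cΛ m)) (unitM (sfStep Lc m) (smStep 3 Lc m) (M1At 3 Lc (toSite r) cΛ m))
            (W2SymOfK (unitK (sfStep Lc m) (smStep 3 Lc m) (coDressKBmAt (toSite r) Lc (KInvStep (d := 3) Lc m))) Lc (unitS (sfStep Lc m) (smStep 3 Lc m) (SpureRecAt 3 Lc (toSite r) cE cVH cΛ m))
              (unitM (sfStep Lc m) (smStep 3 Lc m) (M1At 3 Lc (toSite r) cΛ m)) 0 (unitM₂ (sfStep Lc m) (smStep 3 Lc m) (M2Of 3 Lc (mixFFAt (toSite r) Lc) m))) κ u κ' u')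
          + cB • vh₂S κ u κ' u') -
         (fun κ u κ' u' => (cE₂ * (Lc : ℝ) ^ (2 * (3 + 1))) • mmRead Lc (K3OfK (unitK (sfStep Lc m) (smStep 3 Lc m) (KInvStep (d := 3) Lc m)) Lc
            (unitS (sfStep Lc m) (smStep 3 Lc m) (SpureRecAt 3 Lc (toSite r) cE cVH cΛ m)) (unitM (sfStep Lc m) (smStep 3 Lc m) (M1At 3 Lc (toSite r) cΛ m))
            (W2SymOfK (unitK (sfStep Lc m) (smStep 3 Lc m) (KInvStep (d := 3) Lc m)) Lc (unitS (sfStep Lc m) (smStep 3 Lc m) (SpureRecAt 3 Lc (toSite r) cE cVH cΛ m))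
              (unitM (sfStep Lc m) (smStep 3 Lc m) (M1At 3 Lc (toSite r) cΛ m)) 0 (unitM₂ (sfStep Lc m) (smStep 3 Lc m) (M2Of 3 Lc (mixFFAt (toSite r) Lc) m))) κ u κ' u')
          + cB • vh₂S κ u κ' u'))))) (Ch' * θh ^ m) δh') := by
  have hLc1 : 1 ≤ Lc := le_trans (by norm_num) hLc
  -- road P1's K-slot rows
  obtain ⟨CK, δK, cK, θK, hδK, hθK0, hθK1, hK, hKall⟩ := convCKWall_holds (Lc := Lc) hLc
  -- the dressed comb sources: p2's F4 over the OWNER's hypothesis-free S-slot rows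
  obtain ⟨Cs, cS, θS, δS, hθS0, hθS1, hδS, hall⟩ := exists_hS_hSall_SrecAt_three hLc hcE cVH cΛ
  obtain ⟨hS, hSall⟩ := hall r hr
  obtain ⟨⟨CbE, δbE, hδbE, hbE⟩, ⟨cbE, θbE, δbE', hcbE, hθbE0, hθbE1, hδbE', hbEall⟩⟩ :=
    T2RecSourceRows.source_rows_three_of_srecAt_rows hLc hr cE cVH cΛ cE₂ cB (vh₂S := vh₂S) hB hδB hS hSall hδS hθS0 hθS1
  -- the undressed-kernel comb sources: leaf-04's (A)∕(B)
  obtain ⟨⟨CbB, δbB, hδbB, hbB⟩, ⟨cbB, θbB, δbB', hcbB, hθbB0, hθbB1, hδbB', hbBall⟩⟩ := source_rows_three_holds (r := r) hLc hcE cVH cΛ cE₂ cB hB hδB hr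
  obtain ⟨Ch, δh, hδh, hH⟩ := exists_hH_of_defect_rows (d := 3) hLc1 hr cE cVH cΛ cE₂ cB Tc ⟨CB, δB, hδB, hB⟩ hK hδK hY hδY
    (fun m => (hbE m).mono (min_le_left δbE δbB)) (fun m => (hbB m).mono (min_le_right δbE δbB)) (lt_min hδbE hδbB)
  obtain ⟨Ch', θh, δh', -, hθh0, hθh1, hδh', hHr⟩ := exists_hHr_of_defect_rows (d := 3) hLc1 hr cE cVH cΛ cE₂ cB Tc ⟨CB, δB, hδB, hB⟩ hK hKall hδK hθK0 hθK1
    hY hδY hYr hθY0 hθY1 hδY' (fun m => hbEall m 1) hθbE0 hθbE1 hδbE' (fun m => hbBall m 1) hθbB0 hθbB1 hδbB'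
  exact ⟨Ch, δh, Ch', θh, δh', hδh, hθh0, hθh1, hδh', hH, hHr⟩

end Three

end Summit.QuantumFields.BalabanUV.Beta.GAN24.T2DevConservationDefectThree

end
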